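import Literature.AnabelianGeometry.EtaleTheta.Discharge.Sec2Cor28iiiOuterEndKnitChiCusp
import Literature.AnabelianGeometry.EtaleTheta.Discharge.Sec2Cor28iiiInnerOfEmbedding
import Literature.AnabelianGeometry.EtaleTheta.ThetaCoversTemperedOfHuuSection
import Literature.AnabelianGeometry.EtaleTheta.SettingModelChiCuspDef19Points
import HarnessLib

/-!
# [EtTh] Cor 2.8 (iii) AS TYPED at the cusped inversion model `χ′`: the INNER half (clauses 1–2) at the SECTION-route cover,
# the four-clause END-KNIT, and the RESIDUAL-∅ instance at the Def. 1.9 pair `τ^{±1}` (proof-only)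

S. Mochizuki, *The étale theta function and its Frobenioid-theoretic manifestations* [EtTh], Publ. RIMS **45** (2009), §2,
Cor 2.8 (iii), PRIMS PDF p.42 («if the data for `α, β` are equal, and `γ` arises from an inner automorphism of `Π^tp_{Ẋ̲̲}` (resp.
`Π^tp_{Ẋ̲}`; `Π^tp_{Ċ̲̲}`; `Π^tp_{Ċ̲}`), then `γ` preserves `η̲̈^{Θ,l·ℤ}` (resp. `η̈^{Θ,l·ℤ}`; `η̲̈^{Θ,l·ℤ}`; `η̈^{Θ,l·ℤ}`)»; proof:
«immediate from the definitions», cf. Rmk 1.9.1 p.29), Def 1.9 p.29 (`τ^{±1}`), Def 2.7 p.41 (bib key `MochizukiEtTh2009`).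

PROOF-ONLY companion (0 `def`, 0 `instance`, no new `Prop`; cell abc-iut, layer L2, seat abc-iut-w6-d049 gen 6; abc-iut-L2-lead
R939 «EtTh:Cor2.8(iii) INNER HALF at χ′» — chain G-w6d049-1; every input BY NAME, nothing restated).  abc-iut-L2-t2's typed
`ThetaCovers.ThetaOrbitData.Cor28_iii` quantifies over ITS OWN binders (`x`, `Γ_Θ`, `InducesOnTheta`, `hY`, `hYuu`) and has four
conjuncts: clauses 1–2 (`γ` inner from `Π^tp_{Ẋ̲̲}`, `Π^tp_{Ẋ̲}` — the INNER half) and clauses 3–4 (`γ` inner from `Π^tp_{Ċ̲̲}`,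
`Π^tp_{Ċ̲}` — the OUTER half, closed at `χ′` for every conjugator by abc-iut-w6-d050's `cor28_iii_outer_endKnit_inversionModelχ'`,
p473918, with P-C5 discharged).
* §1 `cor28_iii_inner_orbitEmbeddingOfHuuOfSection` — the INNER half at abc-iut-L2-d3's SECTION-route orbit embedding
  `orbitEmbeddingOfHuuOfSection` (ANY `MuTwoSetting`, any `CLevelData`, section, Def-1.9 pair): abc-iut-L2-t2's generic
  `ofEmbedding_cor28_iii_inner` (p427195) wants exactly ONE identity `ι(Π^tp_{X̲}) = T.tp T.PiXu`, which IS this seat's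
  `orbitEmbeddingOfHuuOfSection_map_GtpXu` (p453395, from abc-iut-L2-d3's `temperedCoverDataOfHuuOfSection_tp_PiXu`) — a one-term
  knit, NO P-C5, modulo Cor 2.8 (iii)'s own binders only.
* §2 **`cor28_iii_endKnit_inversionModelχ'` — `ThetaOrbitData.Cor28_iii` AS TYPED (all four conjuncts; its own binders internal)**
  at `ofEmbedding (orbitEmbeddingOfHuuOfSection …)` over `inversionModelχ′`, for every `CLevelData e`, profinite completion `ιC`,
  section `s`, double-underline `C` with `Π^tp_{X̲̲} = Huuχ` and Def-1.9 pair `τ^{±1}` — modulo the constructor's data binders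
  EXACTLY as in p473918 (`op`, `s`/`hsa`/`hsZ`/`hsH`, `hιell`, `hN`, `hY`, `hK`, `IotaStable`, `τ^{±1}`, `hE`, `hC`): §1 + p473918.
* §3 **RESIDUAL ∅ at the Def. 1.9 pair (`p ≡ 1 (mod 4)`, every odd `l`)** — `cor28_iii_coverOfRecordχ'_tauχ'`: `Cor28_iii` for the
  cover of record over THE completion `toPiCHat`, the Galois section `sectionχ′` (abc-iut-L2-t10), abc-iut-L2-t10's
  `doubleUnderlineχ'Sec` (`Π^tp_{X̲̲} = Huuχ p l`, class `η̈^Θ = etaDdχ`), `hK :=` abc-iut-L2-t10's `barKerTp_le_Huuχ_inversionModelχ'`,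
  `IotaStable :=` `iotaStable_conjX_epsPMInvχ'`, and `τ^{±1} :=` abc-iut-w5-d118's Def. 1.9 points `tauχ'`/`tauInvχ'`
  (`Ü = (√−1)^{±1}`), for EVERY once-punctured datum `eX` (inhabited: `nonempty_oncePuncturedData_modelχ'`); and the binder-free
  ∃-form `exists_orbitEmbedding_cor28_iii_inversionModelχ'`.  For `p ≢ 1 (mod 4)` the Def. 1.9 pair is not constructed at `χ′`
  (`√−1 ∉ K̈`): there the residual is `{τ, τ′}` (§2 keeps them as binders).
* §4 (v2, append-only; v1 declarations byte-identical) **RESIDUAL ∅ for EVERY prime `p`** — `Cor28_iii` does not read the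
  decomposition groups `D_{τ^{±1}}` (only Cor 2.8 (i) does, through `Dtau`), so the two Def-1.9 SLOTS of the orbit embedding may be
  filled by abc-iut-L2-t10's non-cuspidal section point `nonCuspidalPointχ'` (`Ü = 1 + p`, `τ = τ′` — exactly the filling of
  abc-iut-L2-t10's R312 capstone `nonempty_orbitEmbedding_inversionModelχ'`): `cor28_iii_coverOfRecordχ'_nonCuspidalPointχ'` and the
  binder-free `exists_orbitEmbedding_cor28_iii_inversionModelχ'_all` (every `p`, every odd `l`).  HONEST LABEL: a slot filling, not
  the Def. 1.9 pair (which §3 supplies when `√−1 ∈ K̈`).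
HONEST FRAMING: semi-synthetic model (χ-twisted root with a synthetic cusp, synthetic mod-`l` cusp datum; the theta class OF THE MODEL)
= consistency / non-vacuity evidence for the TYPED interface only (abc-iut-L2-t11's `not_forall_cor28_iii`: the universal closure of
`Cor28_iii` over the interface is false — instance form only); [EtTh] is refereed and nothing of it is asserted; no side is taken on
[IUTchIII] Cor 3.12; typed ≠ proved; instantiated ≠ endorsed.
-/

noncomputable section

namespace Literature.AnabelianGeometry.EtaleTheta

open Literature.AnabelianGeometry.SemiGraphs ThetaCovers Literature.IUT.HodgeArakelov
open _root_.Topology _root_.Function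

/-! ## §1. The INNER half (clauses 1–2) at the SECTION-route orbit embedding — any model -/

namespace MuTwoSetting.CLevelData

variable {p : ℕ} [Fact p.Prime] {M : MuTwoSetting p}
variable {PC : Type} [Group PC] [TopologicalSpace PC] [IsTopologicalGroup PC] [T2Space PC]
variable (e : M.CLevelData) (ιC : M.GtpC →ₜ* PC) (hιC : IsProfiniteCompletion ιC)
  (hinj : Function.Injective ιC) (op : M.toThetaSetting.OncePuncturedData) {l : ℕ} (hodd : Odd l)
  (s : ↥M.GK →* M.PiTemp) (hsa : ∀ σ, M.aug (s σ) = (σ : GQp p)) (hsZ : ∀ σ, M.toZ (s σ) = 1)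
  (hιell : ∀ c ∈ (e.piCDataOf ιC hιC).augGK.ker, c ∉ (e.piCDataOf ιC hιC).PiX →
    ∀ d ∈ (e.piCDataOf ιC hιC).PiX ⊓ (e.piCDataOf ιC hιC).augGK.ker,
      c * d * c⁻¹ * d ∈ (e.piCDataOf ιC hιC).barTheta l)
  (hN : ((M.GtpXu l).map M.inclX).Normal) (hY : (M.GtpY.map M.inclX).Normal)
  {E : M.toThetaSetting.EtaleThetaData} (C : E.DoubleUnderline l) (hK : M.barKerTp l ≤ C.Huu)
  (hsH : ∀ σ, s σ ∈ C.Huu) {g : M.GtpC} (hgX : g ∉ M.inclX.range) (hι : C.IotaStable (e.conjX g))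
  (τ τ' : ThetaSetting.NonCuspidalPoint E.toKummerData)

/-- **Cor 2.8 (iii), clauses 1–2 (the INNER half) at `ofEmbedding (orbitEmbeddingOfHuuOfSection …)`**, SECTION route, ANY model:
for every conjugator `x ∈ Π^tp_C`, «if `γ` arises from an inner automorphism of `Π^tp_{Ẋ̲̲}` (resp. `Π^tp_{Ẋ̲}`), then `γ` preserves
`η̲̈^{Θ,l·ℤ}` (resp. `η̈^{Θ,l·ℤ}`)» — abc-iut-L2-t2's `ofEmbedding_cor28_iii_inner` with its single extra identity
`ι(Π^tp_{X̲}) = T.tp T.PiXu` supplied by `orbitEmbeddingOfHuuOfSection_map_GtpXu`; modulo Cor 2.8 (iii)'s own binders only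
(no P-C5: inner conjugators act on cocycles by conjugation inside `Π^tp_X`). [cite: MochizukiEtTh2009, Cor 2.8(iii) p.42] -/
theorem cor28_iii_inner_orbitEmbeddingOfHuuOfSection (hC : M.toThetaSetting.Compat) (hS : M.toThetaSetting.Sec2Hyps)
    (x : (e.temperedCoverDataOfHuuOfSection ιC hιC hinj op hodd s hsa hsZ hιell hN hY C hK hsH hgX hι).Gtp)
    (ΓΘ : (ThetaOrbitData.ofEmbedding
        (e.orbitEmbeddingOfHuuOfSection ιC hιC hinj op hodd s hsa hsZ hιell hN hY C hK hsH hgX hι τ τ') hC hS).DeltaTheta ≃*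
      (ThetaOrbitData.ofEmbedding
        (e.orbitEmbeddingOfHuuOfSection ιC hιC hinj op hodd s hsa hsZ hιell hN hY C hK hsH hgX hι τ τ') hC hS).DeltaTheta)
    (hind : (ThetaOrbitData.ofEmbedding
        (e.orbitEmbeddingOfHuuOfSection ιC hιC hinj op hodd s hsa hsZ hιell hN hY C hK hsH hgX hι τ τ') hC hS).InducesOnTheta
      (ThetaOrbitData.innerAutTop x) ΓΘ)
    (hYmap : (e.temperedCoverDataOfHuuOfSection ιC hιC hinj op hodd s hsa hsZ hιell hN hY C hK hsH hgX hι).PiYddtp.map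
        (ThetaOrbitData.innerAutTop x).toMulEquiv.toMonoidHom =
      (e.temperedCoverDataOfHuuOfSection ιC hιC hinj op hodd s hsa hsZ hιell hN hY C hK hsH hgX hι).PiYddtp)
    (hYuu : ((e.temperedCoverDataOfHuuOfSection ιC hιC hinj op hodd s hsa hsZ hιell hN hY C hK hsH hgX hι).PiYddtp ⊓
          (e.temperedCoverDataOfHuuOfSection ιC hιC hinj op hodd s hsa hsZ hιell hN hY C hK hsH hgX hι).tp
            (e.temperedCoverDataOfHuuOfSection ιC hιC hinj op hodd s hsa hsZ hιell hN hY C hK hsH hgX hι).PiXuu).map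
        (ThetaOrbitData.innerAutTop x).toMulEquiv.toMonoidHom =
      (e.temperedCoverDataOfHuuOfSection ιC hιC hinj op hodd s hsa hsZ hιell hN hY C hK hsH hgX hι).PiYddtp ⊓
        (e.temperedCoverDataOfHuuOfSection ιC hιC hinj op hodd s hsa hsZ hιell hN hY C hK hsH hgX hι).tp
          (e.temperedCoverDataOfHuuOfSection ιC hιC hinj op hodd s hsa hsZ hιell hN hY C hK hsH hgX hι).PiXuu) :
    (x ∈ (e.temperedCoverDataOfHuuOfSection ιC hιC hinj op hodd s hsa hsZ hιell hN hY C hK hsH hgX hι).tp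
          (e.temperedCoverDataOfHuuOfSection ιC hιC hinj op hodd s hsa hsZ hιell hN hY C hK hsH hgX hι).PiXuu ⊓
        (e.temperedCoverDataOfHuuOfSection ιC hιC hinj op hodd s hsa hsZ hιell hN hY C hK hsH hgX hι).PiCdot →
      (ThetaOrbitData.ofEmbedding
          (e.orbitEmbeddingOfHuuOfSection ιC hιC hinj op hodd s hsa hsZ hιell hN hY C hK hsH hgX hι τ τ') hC hS).transport _ _
          hYuu ΓΘ
          (ThetaOrbitData.ofEmbedding
            (e.orbitEmbeddingOfHuuOfSection ιC hιC hinj op hodd s hsa hsZ hιell hN hY C hK hsH hgX hι τ τ') hC hS).rootLZ =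
        (ThetaOrbitData.ofEmbedding
          (e.orbitEmbeddingOfHuuOfSection ιC hιC hinj op hodd s hsa hsZ hιell hN hY C hK hsH hgX hι τ τ') hC hS).rootLZ) ∧
    (x ∈ (e.temperedCoverDataOfHuuOfSection ιC hιC hinj op hodd s hsa hsZ hιell hN hY C hK hsH hgX hι).tp
          (e.temperedCoverDataOfHuuOfSection ιC hιC hinj op hodd s hsa hsZ hιell hN hY C hK hsH hgX hι).PiXu ⊓
        (e.temperedCoverDataOfHuuOfSection ιC hιC hinj op hodd s hsa hsZ hιell hN hY C hK hsH hgX hι).PiCdot →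
      (ThetaOrbitData.ofEmbedding
          (e.orbitEmbeddingOfHuuOfSection ιC hιC hinj op hodd s hsa hsZ hιell hN hY C hK hsH hgX hι τ τ') hC hS).transport _ _
          hYmap ΓΘ
          (ThetaOrbitData.ofEmbedding
            (e.orbitEmbeddingOfHuuOfSection ιC hιC hinj op hodd s hsa hsZ hιell hN hY C hK hsH hgX hι τ τ') hC hS).etaLZ =
        (ThetaOrbitData.ofEmbedding
          (e.orbitEmbeddingOfHuuOfSection ιC hιC hinj op hodd s hsa hsZ hιell hN hY C hK hsH hgX hι τ τ') hC hS).etaLZ) :=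
  ThetaOrbitData.ofEmbedding_cor28_iii_inner
    (e.orbitEmbeddingOfHuuOfSection ιC hιC hinj op hodd s hsa hsZ hιell hN hY C hK hsH hgX hι τ τ') hC hS
    (e.orbitEmbeddingOfHuuOfSection_map_GtpXu ιC hιC hinj op hodd s hsa hsZ hιell hN hY C hK hsH hgX hι τ τ') x ΓΘ hind hYmap hYuu

end MuTwoSetting.CLevelData

/-! ## §2. The END-KNIT at `χ′`: `Cor28_iii` AS TYPED (all four conjuncts) for the SECTION-route cover over `inversionModelχ′` -/

namespace SettingModel

variable (p : ℕ) [Fact p.Prime]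

section EndKnit

variable {PC : Type} [Group PC] [TopologicalSpace PC] [IsTopologicalGroup PC] [T2Space PC]
variable (e : (MuTwoSetting.inversionModelχ' p).CLevelData)
  (ιC : (MuTwoSetting.inversionModelχ' p).GtpC →ₜ* PC) (hιC : IsProfiniteCompletion ιC)
  (hinj : Function.Injective ιC) (op : (MuTwoSetting.inversionModelχ' p).toThetaSetting.OncePuncturedData)
  {l : ℕ+} (hodd : Odd ((l : ℕ+) : ℕ))
  (s : ↥(MuTwoSetting.inversionModelχ' p).GK →* (MuTwoSetting.inversionModelχ' p).PiTemp)
  (hsa : ∀ σ, (MuTwoSetting.inversionModelχ' p).aug (s σ) = (σ : GQp p))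
  (hsZ : ∀ σ, (MuTwoSetting.inversionModelχ' p).toZ (s σ) = 1)
  (hιell : ∀ c ∈ (e.piCDataOf ιC hιC).augGK.ker, c ∉ (e.piCDataOf ιC hιC).PiX →
    ∀ d ∈ (e.piCDataOf ιC hιC).PiX ⊓ (e.piCDataOf ιC hιC).augGK.ker,
      c * d * c⁻¹ * d ∈ (e.piCDataOf ιC hιC).barTheta l)
  (hN : (((MuTwoSetting.inversionModelχ' p).GtpXu l).map (MuTwoSetting.inversionModelχ' p).inclX).Normal)
  (hY : ((MuTwoSetting.inversionModelχ' p).GtpY.map (MuTwoSetting.inversionModelχ' p).inclX).Normal)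
  {E : (MuTwoSetting.inversionModelχ' p).toThetaSetting.EtaleThetaData} (hE : E.etaDd = etaDdχ p)
  (C : E.DoubleUnderline (l : ℕ)) (hC : C.Huu = Huuχ p l)
  (hK : (MuTwoSetting.inversionModelχ' p).barKerTp l ≤ C.Huu) (hsH : ∀ σ, s σ ∈ C.Huu)
  (hι : C.IotaStable (e.conjX (epsPMInvχ p)))
  (τ τ' : ThetaSetting.NonCuspidalPoint E.toKummerData)

include hE hC

/-- **[EtTh] Cor 2.8 (iii) AS TYPED — abc-iut-L2-t2's `ThetaOrbitData.Cor28_iii`, all four conjuncts, its own binders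
(`x`, `Γ_Θ`, `InducesOnTheta`, `hY`, `hYuu`) internal — HOLDS at `ofEmbedding (orbitEmbeddingOfHuuOfSection …)` over the cusped
inversion model `χ′`** for every `CLevelData`, completion, section, double-underline with `Π^tp_{X̲̲} = Huuχ` and Def-1.9 pair:
clauses 1–2 by §1 (inner, no P-C5), clauses 3–4 by abc-iut-w6-d050's `cor28_iii_outer_endKnit_inversionModelχ'` (P-C5 and its
dotted junction discharged at `χ′`).  Residual = the constructor's data binders displayed in the signature, nothing else.
[cite: MochizukiEtTh2009, Cor 2.8(iii) p.42] -/
theorem cor28_iii_endKnit_inversionModelχ' :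
    (ThetaOrbitData.ofEmbedding
      (e.orbitEmbeddingOfHuuOfSection ιC hιC hinj op hodd s hsa hsZ hιell hN hY C hK hsH (epsPMInvχ_not_mem_range p) hι τ τ')
      (MuTwoSetting.inversionModelχ'_compat p) (ThetaSetting.modelχ'_sec2Hyps p)).Cor28_iii := by
  intro x ΓΘ hind hYmap hYuu
  have hin := e.cor28_iii_inner_orbitEmbeddingOfHuuOfSection ιC hιC hinj op hodd s hsa hsZ hιell hN hY C hK hsH
    (epsPMInvχ_not_mem_range p) hι τ τ' (MuTwoSetting.inversionModelχ'_compat p) (ThetaSetting.modelχ'_sec2Hyps p)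
    x ΓΘ hind hYmap hYuu
  have hout := cor28_iii_outer_endKnit_inversionModelχ' p e ιC hιC hinj op hodd s hsa hsZ hιell hN hY hE C hC hK hsH hι τ τ'
    x ΓΘ hind hYmap hYuu
  exact ⟨hin.1, hin.2, hout.1, hout.2⟩

end EndKnit

/-! ## §3. RESIDUAL ∅ at the Def. 1.9 pair `τ^{±1}` (`p ≡ 1 (mod 4)`, every odd `l`) -/

/-- **Cor 2.8 (iii) AS TYPED at the cover of record over `inversionModelχ′`, RESIDUAL ∅** (`p ≡ 1 (mod 4)`, `l` odd): the
SECTION-route cover over THE completion `toPiCHat` with the Galois section `sectionχ′` and `g := ε_±`, abc-iut-L2-t10's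
`doubleUnderlineχ'Sec` (`Π^tp_{X̲̲} = Huuχ p l`, theta class `etaDdχ`), `hK :=` `barKerTp_le_Huuχ_inversionModelχ'` (G-L2d3-7),
`IotaStable :=` `iotaStable_conjX_epsPMInvχ'`, and the Def. 1.9 pair `τ := tauχ'`, `τ′ := tauInvχ'` (`Ü = (√−1)^{±1}`, abc-iut-w5-d118)
— for every once-punctured datum `eX` (an inhabited type: `nonempty_oncePuncturedData_modelχ'`).  Every group-theoretic input a
theorem; NO hypothesis beyond `p ≡ 1 (mod 4)` and `l` odd. [cite: MochizukiEtTh2009, Cor 2.8(iii) p.42] -/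
theorem cor28_iii_coverOfRecordχ'_tauχ' (hp : p % 4 = 1) (l : ℕ+) (hodd : Odd ((l : ℕ+) : ℕ))
    (eX : (MuTwoSetting.inversionModelχ' p).toThetaSetting.OncePuncturedData) :
    (ThetaOrbitData.ofEmbedding
      ((cLevelDataInvχ' p).orbitEmbeddingOfHuuOfSection (cLevelDataInvχ' p).toPiCHat
        (cLevelDataInvχ' p).isProfiniteCompletion_toPiCHat (cLevelDataInvχ' p).toPiCHat_injective eX hodd (sectionχ' p)
        (aug_sectionχ' p) (toZ_sectionχ' p) (inv_ell_piCData_inversionModelχ' p l eX)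
        ((cLevelDataInvχ' p).map_inclX_GtpXu_normal l (kerToZIsCompactlyGenerated_modelχ' p))
        ((cLevelDataInvχ' p).map_inclX_GtpY_normal (kerToZIsCompactlyGenerated_modelχ' p)) (doubleUnderlineχ'Sec p l hodd)
        (barKerTp_le_Huuχ_inversionModelχ' p l hodd) (fun σ => inr_mem_Huuχ p l σ) (epsPMInvχ_not_mem_range p)
        (iotaStable_conjX_epsPMInvχ' p (doubleUnderlineχ'Sec p l hodd) rfl)
        (tauχ' p hp).toNonCuspidalPoint (tauInvχ' p hp).toNonCuspidalPoint)
      (MuTwoSetting.inversionModelχ'_compat p) (ThetaSetting.modelχ'_sec2Hyps p)).Cor28_iii :=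
  cor28_iii_endKnit_inversionModelχ' p (cLevelDataInvχ' p) _ _ _ eX hodd _ _ _ _ _ _ rfl (doubleUnderlineχ'Sec p l hodd) rfl _ _ _
    _ _

/-- **Binder-free ∃-form**: for `p ≡ 1 (mod 4)` and every odd `l` there are a `TemperedCoverData` `T` ON `Π^tp_C(inversionModelχ′)`
and an orbit embedding `ε` of abc-iut-L2-t10's `doubleUnderlineχ'Sec` whose points ARE the Def. 1.9 pair `τ^{±1}` such that abc-iut-L2-t2's
`Cor28_iii` HOLDS AS TYPED for `ThetaOrbitData.ofEmbedding ε` (the node's instance form; its universal closure over the interface is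
refuted, `not_forall_cor28_iii`). [cite: MochizukiEtTh2009, Cor 2.8(iii) p.42] -/
theorem exists_orbitEmbedding_cor28_iii_inversionModelχ' (hp : p % 4 = 1) (l : ℕ+) (hodd : Odd ((l : ℕ+) : ℕ)) :
    ∃ (T : TemperedCoverData.{0} l) (ε : (doubleUnderlineχ'Sec p l hodd).OrbitEmbedding T),
      T.Gtp = (MuTwoSetting.inversionModelχ' p).GtpC ∧ ε.tau = (tauχ' p hp).toNonCuspidalPoint ∧
      ε.tauInv = (tauInvχ' p hp).toNonCuspidalPoint ∧
      (ThetaOrbitData.ofEmbedding ε (MuTwoSetting.inversionModelχ'_compat p) (ThetaSetting.modelχ'_sec2Hyps p)).Cor28_iii := by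
  obtain ⟨eX⟩ := nonempty_oncePuncturedData_modelχ' p
  exact ⟨_, _, rfl, rfl, rfl, cor28_iii_coverOfRecordχ'_tauχ' p hp l hodd eX⟩

/-! ## §4. (v2) RESIDUAL ∅ for EVERY prime: the Def-1.9 slots filled by the non-cuspidal section point (`Cor28_iii` does not read `D_τ`) -/

/-- **Cor 2.8 (iii) AS TYPED at the cover of record over `inversionModelχ′`, RESIDUAL ∅ for EVERY prime `p` and every odd `l`**:
as `cor28_iii_coverOfRecordχ'_tauχ'`, with both Def-1.9 slots of the orbit embedding filled by abc-iut-L2-t10's non-cuspidal section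
point `nonCuspidalPointχ'` (`Ü = 1 + p`; the filling of the R312 capstone) — legitimate for clause (iii), whose statement does not
involve `D_{τ^{±1}}`. [cite: MochizukiEtTh2009, Cor 2.8(iii) p.42] -/
theorem cor28_iii_coverOfRecordχ'_nonCuspidalPointχ' (l : ℕ+) (hodd : Odd ((l : ℕ+) : ℕ))
    (eX : (MuTwoSetting.inversionModelχ' p).toThetaSetting.OncePuncturedData) :
    (ThetaOrbitData.ofEmbedding
      ((cLevelDataInvχ' p).orbitEmbeddingOfHuuOfSection (cLevelDataInvχ' p).toPiCHat
        (cLevelDataInvχ' p).isProfiniteCompletion_toPiCHat (cLevelDataInvχ' p).toPiCHat_injective eX hodd (sectionχ' p)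
        (aug_sectionχ' p) (toZ_sectionχ' p) (inv_ell_piCData_inversionModelχ' p l eX)
        ((cLevelDataInvχ' p).map_inclX_GtpXu_normal l (kerToZIsCompactlyGenerated_modelχ' p))
        ((cLevelDataInvχ' p).map_inclX_GtpY_normal (kerToZIsCompactlyGenerated_modelχ' p)) (doubleUnderlineχ'Sec p l hodd)
        (barKerTp_le_Huuχ_inversionModelχ' p l hodd) (fun σ => inr_mem_Huuχ p l σ) (epsPMInvχ_not_mem_range p)
        (iotaStable_conjX_epsPMInvχ' p (doubleUnderlineχ'Sec p l hodd) rfl)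
        (nonCuspidalPointχ' p) (nonCuspidalPointχ' p))
      (MuTwoSetting.inversionModelχ'_compat p) (ThetaSetting.modelχ'_sec2Hyps p)).Cor28_iii :=
  cor28_iii_endKnit_inversionModelχ' p (cLevelDataInvχ' p) _ _ _ eX hodd _ _ _ _ _ _ rfl (doubleUnderlineχ'Sec p l hodd) rfl _ _ _
    _ _

/-- **Binder-free ∃-form, EVERY prime `p`, every odd `l`**: there are a `TemperedCoverData` `T` ON `Π^tp_C(inversionModelχ′)` and an
orbit embedding `ε` of abc-iut-L2-t10's `doubleUnderlineχ'Sec` (`Π^tp_{X̲̲} = Huuχ p l`, theta class `etaDdχ ≠ 1`) for which abc-iut-L2-t2's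
`Cor28_iii` HOLDS AS TYPED (instance form; the ∀-closure over the interface is refuted, `not_forall_cor28_iii`).
[cite: MochizukiEtTh2009, Cor 2.8(iii) p.42] -/
theorem exists_orbitEmbedding_cor28_iii_inversionModelχ'_all (l : ℕ+) (hodd : Odd ((l : ℕ+) : ℕ)) :
    ∃ (T : TemperedCoverData.{0} l) (ε : (doubleUnderlineχ'Sec p l hodd).OrbitEmbedding T),
      T.Gtp = (MuTwoSetting.inversionModelχ' p).GtpC ∧
      (ThetaOrbitData.ofEmbedding ε (MuTwoSetting.inversionModelχ'_compat p) (ThetaSetting.modelχ'_sec2Hyps p)).Cor28_iii := by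
  obtain ⟨eX⟩ := nonempty_oncePuncturedData_modelχ' p
  exact ⟨_, _, rfl, cor28_iii_coverOfRecordχ'_nonCuspidalPointχ' p l hodd eX⟩

end SettingModel

end Literature.AnabelianGeometry.EtaleTheta

end
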